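import Mathlib
import Literature.Probability.Percolation.CriticalOneArmBKLowerBound
import Literature.Probability.Percolation.SharpnessDCTProofs
import HarnessLib

/-!
# `stub_armPairBK` of line `registered` (crux `BoxGluing`, stmt-CriticalPhenomena-4643):
# arms of distinct clusters occur disjointly (van den Berg–Kesten)

Registered sub-goal `stub_armPairBK` of the lead's skeleton `Cruxes/BoxGluing/Lines/birth.lean`
of the route `PercHyperscalingGluing`: for bond percolation on `ℤ³` at `p_c = criticalProbI 3`,
every `n : ℕ` and every `x ∈ Λ_n = box 3 n`,

  `P(A_0 ∩ A_x) ≤ P(0 ↔ ∂Λ_n)² + P(0 ↔ x inside Λ_{2n})`,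

where `A_y = DCT16.armEvent y n = {y ↔ y + ∂Λ_n inside y + Λ_n}` is the translated one-arm event
(`A_0 = siteToBoundary 3 n` by `DCT16.armEvent_zero`).

Proof (the standard first use of the BK inequality): almost surely `ω ⊆ E(ℤ³)`
(`real_mono_of_forall_subset_edgeSet`). If `ω ∈ A_0 ∩ A_x` but `0` is not joined to `x` inside
`Λ_{2n}`, take an open lattice walk `γ₀` from `0` to `∂Λ_n` inside `Λ_n` and an open lattice walk
`γₓ` from `x` to `x + ∂Λ_n` inside `x + Λ_n` (`exists_walk_of_mem_openConnIn`). Both walks stay in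
`Λ_{2n}` (`x ∈ Λ_n`, `z - x ∈ Λ_n ⟹ z ∈ Λ_{2n}`), so a common vertex `v` would join `0 ↔ v ↔ x`
inside `Λ_{2n}` (`mem_openConnIn_of_mem_support`, transitivity) — excluded. Hence the walks are
vertex-disjoint, so their edge sets are disjoint open witnesses of `A_0` and `A_x`
(`mem_openConnIn_of_walk`), i.e. `ω ∈ A_0 □ A_x` (`IsUpperSet.mem_disjointOccurrence_iff`).
Finally `P(A_0 ∩ A_x) ≤ P(A_0 □ A_x) + P(0 ↔ x in Λ_{2n})` (`measureReal_union_le`),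
`P(A_0 □ A_x) ≤ P(A_0) P(A_x)` (`bk_finitary`, the arm events being increasing and finitary) and
`P(A_x) = P(A_0) = P(0 ↔ ∂Λ_n)` (`DCT16.real_armEvent`).

No new definitions; the two helpers (pure lattice geometry / path bookkeeping, every dimension
`d`) live in the sub-namespace `ArmPairBK`.
-/

noncomputable section

namespace Summit.CriticalPhenomena.PercolationContinuityZ3.Theorems

open MeasureTheory ProbabilityTheory
open Literature.Probability.Percolation Literature.Probability.LatticeModels
open Literature.Probability.Percolation.DCT16
open scoped Literature.Probability.Percolation

namespace ArmPairBK

variable {d : ℕ}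

/-- Geometry of boxes: if `x ∈ Λ_n` and `z - x ∈ Λ_n` then `z ∈ Λ_{2n}` (coordinatewise triangle
inequality). [folklore] -/
theorem mem_box_two_mul_of_sub_mem_box {n : ℕ} {x z : Site d} (hx : x ∈ box d n)
    (hz : z - x ∈ box d n) : z ∈ box d (2 * n) := by
  rw [mem_box] at hx hz ⊢
  intro i
  have h1 := hx i
  have h2 := hz i
  simp only [Pi.sub_apply] at h2
  push_cast
  constructor <;> omega

/-- **Arms of distinct clusters occur disjointly.** For a lattice configuration `ω ⊆ E(ℤ^d)` and
`x ∈ Λ_n`: if `ω ∈ {0 ↔ ∂Λ_n} ∩ {x ↔ x + ∂Λ_n in x + Λ_n}` but `0` is not joined to `x` inside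
`Λ_{2n}`, then the two arm events occur on disjoint sets of open edges: open lattice walks
witnessing the two arms lie in `Λ_{2n}`, so they cannot share a vertex (else `0 ↔ x` inside
`Λ_{2n}`), hence share no edge. [folklore] -/
theorem mem_disjointOccurrence_of_arms {n : ℕ} {x : Site d} (hx : x ∈ box d n)
    {ω : BondConfig (Site d)} (hω : ω ⊆ (zdGraph d).edgeSet) (h₀ : ω ∈ siteToBoundary d n)
    (h₁ : ω ∈ DCT16.armEvent x n)
    (h' : ω ∉ openConnIn (↑(box d (2 * n)) : Set (Site d)) 0 x) :
    ω ∈ siteToBoundary d n □ DCT16.armEvent x n := by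
  classical
  obtain ⟨a, ha, hconn₀⟩ := h₀
  obtain ⟨a', ha', hconn₁⟩ := h₁
  obtain ⟨γ₀, hγ₀S, hγ₀ω⟩ := exists_walk_of_mem_openConnIn hω hconn₀
  obtain ⟨γ₁, hγ₁S, hγ₁ω⟩ := exists_walk_of_mem_openConnIn hω hconn₁
  -- both walks lie in `Λ_{2n}`
  have hn : n ≤ 2 * n := by omega
  have hγ₀S' : ∀ z ∈ γ₀.support, z ∈ (↑(box d (2 * n)) : Set (Site d)) := fun z hz =>
    Finset.mem_coe.2 (box_mono d hn (Finset.mem_coe.1 (hγ₀S z hz)))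
  have hγ₁S' : ∀ z ∈ γ₁.support, z ∈ (↑(box d (2 * n)) : Set (Site d)) := fun z hz =>
    Finset.mem_coe.2 (mem_box_two_mul_of_sub_mem_box hx (hγ₁S z hz))
  -- the walks are vertex-disjoint
  have hsupp : ∀ v ∈ γ₀.support, v ∉ γ₁.support := by
    intro v hv₀ hv₁
    apply h'
    obtain ⟨h0S, hvS, hr₀⟩ := mem_openConnIn_of_mem_support γ₀ hγ₀S' hγ₀ω hv₀
    obtain ⟨hxS, hvS', hr₁⟩ := mem_openConnIn_of_mem_support γ₁ hγ₁S' hγ₁ω hv₁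
    exact ⟨h0S, hxS, hr₀.trans hr₁.symm⟩
  -- the two witnesses
  set K : Set (Sym2 (Site d)) := {e | e ∈ γ₀.edges} with hK
  set L : Set (Sym2 (Site d)) := {e | e ∈ γ₁.edges} with hL
  have hKω : K ⊆ ω := fun e he => hγ₀ω e he
  have hLω : L ⊆ ω := fun e he => hγ₁ω e he
  have hdisj : Disjoint K L := by
    rw [Set.disjoint_left]
    intro e heK heL
    induction e using Sym2.ind with
    | h s t =>
      exact hsupp s (γ₀.fst_mem_support_of_mem_edges heK) (γ₁.fst_mem_support_of_mem_edges heL)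
  have hKA : K ∈ siteToBoundary d n := ⟨a, ha, mem_openConnIn_of_walk γ₀ hγ₀S fun e he => he⟩
  have hLB : L ∈ DCT16.armEvent x n := ⟨a', ha', mem_openConnIn_of_walk γ₁ hγ₁S fun e he => he⟩
  exact ((isUpperSet_siteToBoundary d n).mem_disjointOccurrence_iff
    (isUpperSet_armEvent_translate x n) ω).2 ⟨K, hKω, L, hLω, hdisj, hKA, hLB⟩

end ArmPairBK

/-- **Sub-goal `stub_armPairBK` of `Cruxes/BoxGluing/Lines/birth.lean` — BK FOR A PAIR OF ARMS.**
For bond percolation on `ℤ³` at `p_c = criticalProbI 3`, every `n : ℕ` and every `x ∈ Λ_n`: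
`P_{p_c}(A_0 ∩ A_x) ≤ P_{p_c}(0 ↔ ∂Λ_n)² + P_{p_c}(0 ↔ x inside Λ_{2n})`, where
`A_y = DCT16.armEvent y n`: a.s. `ω ⊆ E(ℤ³)`, and on `A_0 ∩ A_x ∖ {0 ↔ x in Λ_{2n}}` the two arm
events occur disjointly (`ArmPairBK.mem_disjointOccurrence_of_arms`), whence the bound by
subadditivity, BK (`bk_finitary`) and translation invariance (`DCT16.real_armEvent`). [folklore] -/
theorem stub_armPairBK :
    ∀ n : ℕ, ∀ x ∈ Literature.Probability.LatticeModels.box 3 n,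
      (Literature.Probability.Percolation.bondPercolation
          (Literature.Probability.LatticeModels.zdGraph 3)
          (Literature.Probability.Percolation.criticalProbI 3)).real
        (Literature.Probability.Percolation.DCT16.armEvent 0 n ∩
          Literature.Probability.Percolation.DCT16.armEvent x n) ≤
      (Literature.Probability.Percolation.bondPercolation
          (Literature.Probability.LatticeModels.zdGraph 3)
          (Literature.Probability.Percolation.criticalProbI 3)).real
        (Literature.Probability.Percolation.siteToBoundary 3 n) ^ 2 +
      (Literature.Probability.Percolation.bondPercolation
          (Literature.Probability.LatticeModels.zdGraph 3)
          (Literature.Probability.Percolation.criticalProbI 3)).real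
        (Literature.Probability.Percolation.openConnIn
          ↑(Literature.Probability.LatticeModels.box 3 (2 * n)) 0 x) := by
  classical
  intro n x hx
  rw [DCT16.armEvent_zero]
  calc (bondPercolation (zdGraph 3) (criticalProbI 3)).real (siteToBoundary 3 n ∩ DCT16.armEvent x n)
      ≤ (bondPercolation (zdGraph 3) (criticalProbI 3)).real
          ((siteToBoundary 3 n □ DCT16.armEvent x n) ∪
            openConnIn (↑(box 3 (2 * n)) : Set (Site 3)) 0 x) :=
        real_mono_of_forall_subset_edgeSet (zdGraph 3) _ fun ω hω h => by
          by_cases h' : ω ∈ openConnIn (↑(box 3 (2 * n)) : Set (Site 3)) 0 x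
          · exact Or.inr h'
          · exact Or.inl (ArmPairBK.mem_disjointOccurrence_of_arms hx hω h.1 h.2 h')
    _ ≤ (bondPercolation (zdGraph 3) (criticalProbI 3)).real
            (siteToBoundary 3 n □ DCT16.armEvent x n) +
          (bondPercolation (zdGraph 3) (criticalProbI 3)).real
            (openConnIn (↑(box 3 (2 * n)) : Set (Site 3)) 0 x) :=
        measureReal_union_le _ _
    _ ≤ (bondPercolation (zdGraph 3) (criticalProbI 3)).real (siteToBoundary 3 n) *
            (bondPercolation (zdGraph 3) (criticalProbI 3)).real (DCT16.armEvent x n) +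
          (bondPercolation (zdGraph 3) (criticalProbI 3)).real
            (openConnIn (↑(box 3 (2 * n)) : Set (Site 3)) 0 x) := by
        gcongr
        exact bk_finitary (zdGraph 3) _ (isUpperSet_siteToBoundary 3 n)
          (isUpperSet_armEvent_translate x n) (isFinitary_siteToBoundary 3 n)
          (isFinitary_armEvent_translate x n)
    _ = (bondPercolation (zdGraph 3) (criticalProbI 3)).real (siteToBoundary 3 n) ^ 2 +
          (bondPercolation (zdGraph 3) (criticalProbI 3)).real
            (openConnIn (↑(box 3 (2 * n)) : Set (Site 3)) 0 x) := by
        rw [DCT16.real_armEvent, sq]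

end Summit.CriticalPhenomena.PercolationContinuityZ3.Theorems

end
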